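import Literature.NumberTheory.ComplexMultiplication.EllipticUnits.ImaginaryQuadraticMainConjectureCarriersOExist
import Literature.NumberTheory.ComplexMultiplication.EllipticUnits.ImaginaryQuadraticMainConjectureCarriersCores
import HarnessLib

/-!
# The corestrictions `cor_{F'/F}` between the `𝒪`-coefficient level groups `H^i(G_S(F), 𝒪 ⊗ μ_{p^k} ⊗ θ)` of
# Johnson-Leung–Kings 2011 Def. 4.2 (94): transitivity, equivariance, `𝒪`-linearity, compatibility with reduction

INPUTS hand `bsd-inputs-honda-p1` g22 (prover-bsd-inputs-honda-p1-g22-0); brick 2/4 of the UNIT HALF of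
`Nonempty (TwistedIwasawaDataO …)` (row D2-O-EXIST of crux L `SmallImageLowerHalfBothSigns`, stmt-BirchSwinnertonDyer-23599,
line `rtt_w3`, LEAD `cruxlead-stmt-BirchSwinnertonDyer-23599` g9). The `𝒪 = 𝒪_p(χ)`-coefficient twin of the cell
`bsd-print-cf2` file `…CarriersCores` (route C, `ℤ_p`): the laws of `…CarriersO.relCoresO` that the zeta pins (Z1)/(Z2) of
`TwistedIwasawaDataO` consume when a norm-compatible system of `t_p(χ) ⊗` twisted Kummer classes living on Kato's levels
`K(p^s𝔣)` is pushed to the `ℤ_p²`-layers `K̃_n` ("`_𝔞ζ_{K_n}(χ) = tr_{K(𝔣_χ p^{r+n})/K_n}(_𝔞z ⊗ t(χ))`", Burungale–Flach, proof of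
Lemma 7). Theorems only; no definition, no named fact, no `instance`, no `sorry`; nothing about BSD or Cor. 5.3 is proved.

* **`relCoresO_one_eq_coresLe`** — in degree `1`, `relCoresO` IS the tree's transfer corestriction `coresLe` of the ONE ambient
  `G_S`-module `(coeffGSO S P θ k).toTopRep` (tree `cores_eq_cor`);
* **`relCoresO_relCoresO_one`** — TRANSITIVITY `cor_{F'/F} ∘ cor_{F''/F'} = cor_{F''/F}` in degree `1` (tree `coresLe_comp`);
* **`relCoresO_levelConjO`** — EQUIVARIANCE `cor ∘ (γ ·) = (γ ·) ∘ cor`, all degrees (tree `relCor_conjMap`);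
* **`relCoresO_map_levelMapHomO`** — NATURALITY IN THE COEFFICIENTS for any `Γ_K`-equivariant coefficient map, all degrees
  (honda g22's `relCor_cohomologyMap`), whence **`relCoresO_levelScalarO`** (the corestrictions are `𝒪`-LINEAR) and
  **`relCoresO_levelRedO`** (compatibility with `ζ ↦ ζ^p`, ALL degrees — the `ℤ_p` twin has positive degrees only), and on
  consecutive layers **`layerCoresO_layerRedO`**.

References: [JohnsonLeungKings2011] Def. 4.2 (94) (arXiv p0012:L94), Def. 3.5 (p0010:L72–80), §4.1–4.2 (p0012:L59–60, L109–112);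
[NeukirchSchmidtWingberg2008] I §5 Prop. 1.5.2, 1.5.3 (iii), 1.5.4; [SerreGaloisCohomology1997] I §2.5; [Kato2004Asterisque] §8.2.
-/

noncomputable section

open scoped NumberField
open CategoryTheory Field IsDedekindDomain
open Literature.NumberTheory.GaloisRepresentations
open Literature.NumberTheory.GaloisRepresentations.DiscreteGaloisModule
open Literature.NumberTheory.EllipticCurves

namespace Literature.NumberTheory.ComplexMultiplication.EllipticUnits.JohnsonLeungKings2011

variable {K : Type} [Field K] [NumberField K] {p : ℕ} [Fact p.Prime] (S : Set (PadicAlgCl p))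
  (P : Set (HeightOneSpectrum (𝓞 K))) (θ : absoluteGaloisGroup K →ₜ* (padicCoeffIntegers S)ˣ)

/-! ## §1 Degree one: `relCoresO = coresLe`, and transitivity -/

section DegreeOne

variable {U U' U'' : Subgroup (absoluteGaloisGroup K)}

/-- **In degree `1`, `relCoresO` is the transfer corestriction `coresLe`** of the ONE ambient `G_S`-module
`(coeffGSO S P θ k).toTopRep` along `imGS P U' ≤ imGS P U` (tree `cores_eq_cor`), for ANY `Fintype` instance on the index set.
[cite: SerreGaloisCohomology1997, I §2.5] [cite: NeukirchSchmidtWingberg2008, I §5 Prop. 1.5.4] -/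
theorem relCoresO_one_eq_coresLe (h : U' ≤ U) (hU : IsOpen (U : Set (absoluteGaloisGroup K)))
    (hU' : IsOpen (U' : Set (absoluteGaloisGroup K))) (k : ℕ)
    [inst : Fintype (↥(imGS P U) ⧸ (imGS P U').subgroupOf (imGS P U))] (c : levelCohO S P θ U' k 1) :
    relCoresO S P θ h hU hU' k 1 c =
      coresLe (coeffGSO S P θ k).toTopRep (imGS_le_of_le P h) (isOpen_imGS_of_isOpen P hU') c := by
  haveI : TotallyDisconnectedSpace (GaloisGroupUnramifiedOutside K P) :=
    Literature.GroupTheory.ProfiniteSubquotients.totallyDisconnectedSpace_quotient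
      (ramificationSubgroup K P) (ramificationSubgroup_isClosed K P)
  haveI : CompactSpace (imGS P U) := isCompact_iff_compactSpace.mp (isClosed_imGS' P hU).isCompact
  haveI : IsClosed (((imGS P U').subgroupOf (imGS P U) : Subgroup (imGS P U)) : Set (imGS P U)) :=
    (isClosed_imGS' P hU').preimage continuous_subtype_val
  haveI : ((imGS P U').subgroupOf (imGS P U)).FiniteIndex := by
    haveI := finiteIndex_imGS' P hU'
    infer_instance
  have e : inst = Fintype.ofFinite _ := Subsingleton.elim _ _
  subst e
  letI : Fintype (↥(imGS P U) ⧸ (imGS P U').subgroupOf (imGS P U)) := Fintype.ofFinite _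
  rw [coresLe, LinearMap.coe_comp, Function.comp_apply]
  exact (cores_eq_cor ((imGS P U').subgroupOf (imGS P U)) (levelRepO S P θ U k)
    (isOpen_subgroupOf (imGS P U) (isOpen_imGS_of_isOpen P hU')) _).symm

/-- **Transitivity of the corestrictions in degree `1`**: `cor_{F'/F} (cor_{F''/F'} c) = cor_{F''/F} c` for open
`U'' ≤ U' ≤ U` — the transitivity of the traces `tr` of Def. 3.5 / §5.2, which makes
"`_𝔞ζ_{K_n}(χ) = tr_{K(𝔣_χp^{r+n})/K_n}(… ⊗ t_p(χ))`" independent of the auxiliary level.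
[cite: NeukirchSchmidtWingberg2008, I §5 Prop. 1.5.3 (iii)] [cite: JohnsonLeungKings2011, Def. 3.5 (arXiv p0010:L72–80)] -/
theorem relCoresO_relCoresO_one (h' : U'' ≤ U') (h : U' ≤ U) (hU : IsOpen (U : Set (absoluteGaloisGroup K)))
    (hU' : IsOpen (U' : Set (absoluteGaloisGroup K))) (hU'' : IsOpen (U'' : Set (absoluteGaloisGroup K)))
    (k : ℕ) (c : levelCohO S P θ U'' k 1) :
    relCoresO S P θ h hU hU' k 1 (relCoresO S P θ h' hU' hU'' k 1 c) = relCoresO S P θ (h'.trans h) hU hU'' k 1 c := by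
  haveI : ((imGS P U').subgroupOf (imGS P U)).FiniteIndex := by
    haveI := finiteIndex_imGS' P hU'
    infer_instance
  haveI : ((imGS P U'').subgroupOf (imGS P U')).FiniteIndex := by
    haveI := finiteIndex_imGS' P hU''
    infer_instance
  haveI : ((imGS P U'').subgroupOf (imGS P U)).FiniteIndex := by
    haveI := finiteIndex_imGS' P hU''
    infer_instance
  letI : Fintype (↥(imGS P U) ⧸ (imGS P U').subgroupOf (imGS P U)) := Fintype.ofFinite _
  letI : Fintype (↥(imGS P U') ⧸ (imGS P U'').subgroupOf (imGS P U')) := Fintype.ofFinite _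
  letI : Fintype (↥(imGS P U) ⧸ (imGS P U'').subgroupOf (imGS P U)) := Fintype.ofFinite _
  rw [relCoresO_one_eq_coresLe, relCoresO_one_eq_coresLe, relCoresO_one_eq_coresLe, ← LinearMap.comp_apply,
    coresLe_comp]

end DegreeOne

/-! ## §2 Equivariance under `Γ_K` (all degrees) -/

section Conj

variable {U U' : Subgroup (absoluteGaloisGroup K)} [U.Normal] [U'.Normal]

/-- **The corestrictions intertwine the conjugation operators**: `cor_{F'/F} ∘ (γ ·) = (γ ·) ∘ cor_{F'/F}` for
`γ ∈ Γ_K`, `F ⊆ F'` Galois over `K`, all degrees (tree `relCor_conjMap`; part I's `layerCoresO_layerConjO` is the case of two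
consecutive layers). [cite: NeukirchSchmidtWingberg2008, I §5 Prop. 1.5.4] [cite: JohnsonLeungKings2011, §4.2 (arXiv p0012:L109–112)] -/
theorem relCoresO_levelConjO (h : U' ≤ U) (hU : IsOpen (U : Set (absoluteGaloisGroup K)))
    (hU' : IsOpen (U' : Set (absoluteGaloisGroup K))) (k i : ℕ) (γ : absoluteGaloisGroup K)
    (c : levelCohO S P θ U' k i) :
    relCoresO S P θ h hU hU' k i (levelConjO S P θ U' k i γ c) =
      levelConjO S P θ U k i γ (relCoresO S P θ h hU hU' k i c) := by
  haveI : TotallyDisconnectedSpace (GaloisGroupUnramifiedOutside K P) :=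
    Literature.GroupTheory.ProfiniteSubquotients.totallyDisconnectedSpace_quotient
      (ramificationSubgroup K P) (ramificationSubgroup_isClosed K P)
  haveI := normal_imGS P U
  haveI := normal_imGS P U'
  haveI : IsClosed (imGS P U : Set (GaloisGroupUnramifiedOutside K P)) := isClosed_imGS' _ hU
  haveI : IsClosed (imGS P U' : Set (GaloisGroupUnramifiedOutside K P)) := isClosed_imGS' _ hU'
  haveI : ((imGS P U').subgroupOf (imGS P U)).FiniteIndex := by
    haveI := finiteIndex_imGS' P hU'
    infer_instance
  letI : Fintype (↥(imGS P U) ⧸ (imGS P U').subgroupOf (imGS P U)) := Fintype.ofFinite _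
  exact relCor_conjMap (imGS P U) (imGS P U') (coeffGSO S P θ k) (toUnramifiedQuot K P γ) (Subgroup.map_mono h) i c

end Conj

/-! ## §3 Naturality in the coefficients (all degrees): `𝒪`-linearity and compatibility with the reduction -/

section Coeff

variable {U U' : Subgroup (absoluteGaloisGroup K)}

/-- **The corestrictions are natural in every `Γ_K`-equivariant coefficient map** `f : 𝒪 ⊗ μ_{p^k} ⊗ θ → 𝒪 ⊗ μ_{p^{k'}} ⊗ θ`:
`cor_{F'/F} ∘ H^i(f) = H^i(f) ∘ cor_{F'/F}`, all degrees (`relCor_cohomologyMap`; the level maps `H^i(f)` are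
`…CarriersOExist.map_levelMapHomO_eq_cohomologyMap`). [cite: NeukirchSchmidtWingberg2008, I §5 Prop. 1.5.2] [cite: Kato2004Asterisque, §8.2 (p. 180)] -/
theorem relCoresO_map_levelMapHomO (h : U' ≤ U) (hU : IsOpen (U : Set (absoluteGaloisGroup K)))
    (hU' : IsOpen (U' : Set (absoluteGaloisGroup K))) {k k' : ℕ} (i : ℕ)
    (f : OMuCarrier K S (p ^ k) →+ OMuCarrier K S (p ^ k'))
    (hf : ∀ (σ : absoluteGaloisGroup K) (x : OMuCarrier K S (p ^ k)), f (muTwistO S θ k σ x) = muTwistO S θ k' σ (f x))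
    (c : levelCohO S P θ U' k i) :
    relCoresO S P θ h hU hU' k' i ((ContinuousCohomology.map (ContinuousMonoidHom.id _) (levelMapHomO S P θ U' f hf) i).hom c) =
      (ContinuousCohomology.map (ContinuousMonoidHom.id _) (levelMapHomO S P θ U f hf) i).hom
        (relCoresO S P θ h hU hU' k i c) := by
  haveI : TotallyDisconnectedSpace (GaloisGroupUnramifiedOutside K P) :=
    Literature.GroupTheory.ProfiniteSubquotients.totallyDisconnectedSpace_quotient
      (ramificationSubgroup K P) (ramificationSubgroup_isClosed K P)
  haveI : IsClosed (imGS P U : Set (GaloisGroupUnramifiedOutside K P)) := isClosed_imGS' _ hU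
  haveI : IsClosed (imGS P U' : Set (GaloisGroupUnramifiedOutside K P)) := isClosed_imGS' _ hU'
  haveI : ((imGS P U').subgroupOf (imGS P U)).FiniteIndex := by
    haveI := finiteIndex_imGS' P hU'
    infer_instance
  letI : Fintype (↥(imGS P U) ⧸ (imGS P U').subgroupOf (imGS P U)) := Fintype.ofFinite _
  exact relCor_cohomologyMap (imGS P U) (imGS P U') (coeffGSO S P θ k) (coeffGSO S P θ k')
    (coeffMapHomO S P θ f hf) (Subgroup.map_mono h) i c

/-- **The corestrictions are `𝒪`-linear**: `cor_{F'/F} (c · y) = c · cor_{F'/F} y` for the coefficient multiplication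
`H^i(c ⊗ id)`, all degrees. [cite: JohnsonLeungKings2011, §4.1 Def. 4.1 and §4.2 (arXiv p0012:L59–60, L109–112)] [cite: NeukirchSchmidtWingberg2008, I §5 Prop. 1.5.2] -/
theorem relCoresO_levelScalarO (h : U' ≤ U) (hU : IsOpen (U : Set (absoluteGaloisGroup K)))
    (hU' : IsOpen (U' : Set (absoluteGaloisGroup K))) (k i : ℕ) (c : padicCoeffIntegers S) (y : levelCohO S P θ U' k i) :
    relCoresO S P θ h hU hU' k i (levelScalarO S P θ U' k i c y) =
      levelScalarO S P θ U k i c (relCoresO S P θ h hU hU' k i y) := by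
  rw [levelScalarO_apply, levelScalarO_apply]
  exact relCoresO_map_levelMapHomO S P θ h hU hU' i (oMuScalar S (p ^ k) c) (oMuScalar_muTwistO S θ k c) y

/-- **The corestrictions commute with the reduction of coefficients** `𝒪 ⊗ μ_{p^{k+1}} ⊗ θ → 𝒪 ⊗ μ_{p^k} ⊗ θ`:
`cor_{F'/F} (red y) = red (cor_{F'/F} y)`, ALL degrees. [cite: NeukirchSchmidtWingberg2008, I §5 Prop. 1.5.2] [cite: Kato2004Asterisque, §8.2 (p. 180)] -/
theorem relCoresO_levelRedO (h : U' ≤ U) (hU : IsOpen (U : Set (absoluteGaloisGroup K)))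
    (hU' : IsOpen (U' : Set (absoluteGaloisGroup K))) (k i : ℕ) (y : levelCohO S P θ U' (k + 1) i) :
    relCoresO S P θ h hU hU' k i (levelRedO S P θ U' k i y) =
      levelRedO S P θ U k i (relCoresO S P θ h hU hU' (k + 1) i y) := by
  rw [levelRedO_apply, levelRedO_apply]
  exact relCoresO_map_levelMapHomO S P θ h hU hU' i (oMuRed S k) (oMuRed_muTwistO S θ k) y

end Coeff

/-! ## §4 The `ℤ_p²`-layers: `layerCoresO ∘ layerRedO = layerRedO ∘ layerCoresO` -/

section Layers

variable (κ₁ κ₂ : ZpExtension K p) (𝔣 : Ideal (𝓞 K))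

/-- **The two transition systems of `∏_{n,k} H^i(G_S(K̃_n), 𝒪 ⊗ μ_{p^k} ⊗ θ)` commute**:
`cor_{K̃_{n+1}/K̃_n} ∘ red = red ∘ cor_{K̃_{n+1}/K̃_n}` (all degrees). [cite: JohnsonLeungKings2011, Def. 4.2 (94) (arXiv p0012:L94)] [cite: Kato2004Asterisque, §8.2 (p. 180)] -/
theorem layerCoresO_layerRedO (n k i : ℕ) (c : layerCohO S κ₁ κ₂ θ 𝔣 (n + 1) (k + 1) i) :
    layerCoresO S κ₁ κ₂ θ 𝔣 n k i (layerRedO S κ₁ κ₂ θ 𝔣 (n + 1) k i c) =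
      layerRedO S κ₁ κ₂ θ 𝔣 n k i (layerCoresO S κ₁ κ₂ θ 𝔣 n (k + 1) i c) :=
  relCoresO_levelRedO S (suppPF p 𝔣) θ (pairLayerSubgroup_antitone κ₁ κ₂ (Nat.le_succ n))
    (isOpen_pairLayerSubgroup κ₁ κ₂ n) (isOpen_pairLayerSubgroup κ₁ κ₂ (n + 1)) k i c

end Layers

end Literature.NumberTheory.ComplexMultiplication.EllipticUnits.JohnsonLeungKings2011

end
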